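import Summits.CriticalPhenomena.SAWScalingLimit.Theorems.SAWDefectDecoherenceBoundaryClosureRZigzagDiscretisationSimply
import Summits.CriticalPhenomena.SAWScalingLimit.Theorems.SAWDefectDecoherenceBoundaryClosureRZigzagDiscretisationExact
import Summits.CriticalPhenomena.SAWScalingLimit.Theorems.SAWDefectDecoherenceBoundaryClosureRInnerPolygonsWalks
import Summits.CriticalPhenomena.SAWScalingLimit.Theorems.SAWDefectDecoherenceBoundaryClosureRSqueezeMembership
import HarnessLib

/-!
# Crux `BoundaryClosureR` (stmt-CriticalPhenomena-14004), line `polygon-parity-squeeze`,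
# stub `stub_innerPolygonsOfZigzag` (7b): the lattice discretisation of an inner zigzag polygon

Landing target:
`Summits/CriticalPhenomena/SAWScalingLimit/Theorems/SAWDefectDecoherenceBoundaryClosureRZigzagDiscretisation.lean`
(`--supports stmt-CriticalPhenomena-14004`; THE REGISTERED STUB `stub_innerPolygonsOfZigzag` of the line
`polygon-parity-squeeze`: (IP) = this ∘ `stub_innerZigzagPolygonSep` is the only missing input of the
landed squeeze `squeeze_of_innerPolygons`).

**Statement.** If every Dobrushin domain with two pinned flat half-discs admits inner zigzag polygons
`P` with separated corners and local charts (the antecedent, = the conclusion of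
`stub_innerZigzagPolygonSep`), then every admissible pinned family `(Λ, m, b; a, r₀, m₀)` of `Ω` admits,
for every collar width `η > 0`, an inner polygon `P` (same pins, `η`-interior inside) and an
EXACT POLYGON FAMILY `Λ^P` of `P`, admissible with the same pins and sandwiched between the
collar-deleted family and `Λ`.

**Proof (assembly of the `…ZigzagDiscretisation*` building blocks).**  Apply the antecedent to
`(Ω, ρ, r₁ := min r₀ ρ, η/2)`; read the corner charts into a chart function `κ`; take
`Λ^P_δ := zdLam P Cor κ r (pt 1) (pt 0) ρ r₁ Λ m m₀ δ` (faces of `Λ δ` passing every local exactness test,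
thresholds = the pins on the pinned segments, float-shifted least exact thresholds elsewhere).  Then:
carrier by definition; pins, boundary mid-edges `a δ, b δ` and the sandwich from K4
(`eventually_collar_subset_zdLam`) and `eventually_sandwich_frame`; exhaustion of compacts of `P` by K2
(`eventually_mem_zdLam_of_deep`); connectivity C1 (`eventually_preconnected`), simple connectivity C2
(`eventually_simplyConnected`); exactness (`eventually_isFlatSideAt`, `eventually_isCornerAt`) with
the corner set of `P` and radius `r/2`; walks `a δ → b δ` by `eventually_nonempty_hexMidEdgeSAW`.

Sources: H. Duminil-Copin, S. Smirnov, Ann. of Math. 175 (2012) §2–§3 and Conjecture 2; G. Lawler,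
O. Schramm, W. Werner (2004) §3.4; the line card `Cruxes/BoundaryClosureR/Lines/polygon-parity-squeeze.md`.
No proposition is defined and no named fact is introduced.
-/

noncomputable section

open scoped ComplexConjugate Topology
open Set Metric Filter
open Literature.Probability.LatticeModels Literature.Probability.RandomPlanarGeometry
  Literature.Probability.RandomPlanarGeometry.SAW

namespace Summit.CriticalPhenomena.SAWScalingLimit.Theorems.PolygonParitySqueeze

namespace ZigzagDiscretisation

/-! ### Preliminaries: depth of a compact; the chart function -/

/-- **A compact subset of an open set is uniformly deep.** [folklore] -/
theorem exists_pos_le_infDist {K U : Set ℂ} (hK : IsCompact K) (hU : IsOpen U) (hKU : K ⊆ U) (hUc : Uᶜ.Nonempty) :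
    ∃ t : ℝ, 0 < t ∧ ∀ x ∈ K, t ≤ infDist x Uᶜ := by
  rcases K.eq_empty_or_nonempty with rfl | hne
  · exact ⟨1, one_pos, fun x hx => absurd hx (notMem_empty x)⟩
  obtain ⟨x₀, hx₀, hmin⟩ := hK.exists_isMinOn hne (continuous_infDist_pt Uᶜ).continuousOn
  refine ⟨infDist x₀ Uᶜ, (hU.isClosed_compl.notMem_iff_infDist_pos hUc).1 (fun h => h (hKU hx₀)), fun x hx => ?_⟩
  have := hmin hx
  rwa [mem_setOf_eq] at this

/-- Reading the corner charts into a chart function `κ c = (k, k', convex?)`. [folklore] -/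
theorem exists_chartFunction {S : Set ℂ} {Cor : Finset ℂ} {r : ℝ}
    (h : ∀ z ∈ Cor, ∃ k k' : Fin 6, S ∩ ball z (2 * r) = halfPlane k z ∩ halfPlane k' z ∩ ball z (2 * r) ∨
      S ∩ ball z (2 * r) = (halfPlane k z ∪ halfPlane k' z) ∩ ball z (2 * r)) :
    ∃ κ : ℂ → Fin 6 × Fin 6 × Bool, ∀ c ∈ Cor,
      ((κ c).2.2 = true ∧ S ∩ ball c (2 * r) = halfPlane (κ c).1 c ∩ halfPlane (κ c).2.1 c ∩ ball c (2 * r)) ∨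
      ((κ c).2.2 = false ∧ S ∩ ball c (2 * r) = (halfPlane (κ c).1 c ∪ halfPlane (κ c).2.1 c) ∩ ball c (2 * r)) := by
  classical
  choose! kf kf' hk using h
  refine ⟨fun c => (kf c, kf' c, decide (S ∩ ball c (2 * r) = halfPlane (kf c) c ∩ halfPlane (kf' c) c ∩ ball c (2 * r))),
    fun c hc => ?_⟩
  by_cases hA : S ∩ ball c (2 * r) = halfPlane (kf c) c ∩ halfPlane (kf' c) c ∩ ball c (2 * r)
  · exact Or.inl ⟨by simp [hA], hA⟩
  · exact Or.inr ⟨by simp [hA], (hk c hc).resolve_left hA⟩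

end ZigzagDiscretisation

open ZigzagDiscretisation

/-- **(7b) The lattice discretisation of an inner zigzag polygon** (registered stub
`stub_innerPolygonsOfZigzag` of the line `polygon-parity-squeeze`): inner zigzag polygons with separated
corners and local charts (the conclusion of `stub_innerZigzagPolygonSep`) yield the inner exact polygon
families (IP) of the squeeze — same pins, `η`-interior inside, admissible with gate radius `ρ/2`, an
EXACT POLYGON FAMILY, root-pinned with radius `min r₀ ρ / 4`, sandwiched
`collarDomain D (3ρ/4) (min r₀ ρ/2) η δ (Λ δ) ⊆ Λ^P_δ ⊆ Λ δ`.
[cite: DuminilCopinSmirnov2012, §2 (domains of the hexagonal lattice) and Conjecture 2] -/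
theorem stub_innerPolygonsOfZigzag : (∀ (D : DobrushinDomain) (ρ r₁ η : ℝ), 0 < ρ → 0 < r₁ → 0 < η → D.carrier ∩ Metric.ball (D.pt 1) ρ = {z : ℂ | (D.pt 1).im < z.im} ∩ Metric.ball (D.pt 1) ρ → D.carrier ∩ Metric.ball (D.pt 0) r₁ = {z : ℂ | (D.pt 0).im < z.im} ∩ Metric.ball (D.pt 0) r₁ → ρ + r₁ ≤ dist (D.pt 0) (D.pt 1) → ∃ (P : DobrushinDomain) (corners : Finset ℂ) (r : ℝ), P.pt 0 = D.pt 0 ∧ P.pt 1 = D.pt 1 ∧ P.carrier ⊆ D.carrier ∧ {z : ℂ | z ∈ D.carrier ∧ η ≤ Metric.infDist z D.carrierᶜ} ⊆ P.carrier ∧ P.carrier ∩ Metric.ball (D.pt 1) (7 * ρ / 8) = {z : ℂ | (D.pt 1).im < z.im} ∩ Metric.ball (D.pt 1) (7 * ρ / 8) ∧ P.carrier ∩ Metric.ball (D.pt 0) (7 * r₁ / 8) = {z : ℂ | (D.pt 0).im < z.im} ∩ Metric.ball (D.pt 0) (7 * r₁ / 8) ∧ frontier P.carrier \ (Metric.ball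 (D.pt 1) (15 * ρ / 16) ∪ Metric.ball (D.pt 0) (15 * r₁ / 16)) ⊆ D.carrier ∧ 0 < r ∧ r ≤ ρ / 16 ∧ r ≤ r₁ / 16 ∧ (↑corners : Set ℂ) ⊆ frontier P.carrier ∧ (∀ i : Fin 2, ∀ c ∈ corners, r ≤ dist (P.pt i) c) ∧ (∀ c ∈ corners, ∀ c' ∈ corners, c ≠ c' → 4 * r ≤ dist c c') ∧ (∀ z ∈ frontier P.carrier, (∀ c ∈ corners, r ≤ dist z c) → ∃ k : Fin 6, P.carrier ∩ Metric.ball z (r / 2) = halfPlane k z ∩ Metric.ball z (r / 2)) ∧ (∀ z ∈ corners, ∃ k k' : Fin 6, P.carrier ∩ Metric.ball z (2 * r) = halfPlane k z ∩ halfPlane k' z ∩ Metric.ball z (2 * r) ∨ P.carrier ∩ Metric.ball z (2 * r) = (halfPlane k z ∪ halfPlane k' z) ∩ Metric.ball z (2 * r))) → (∀ (D : DobrushinDomain) (ρ : ℝ) (Λ : ℝ → Finset HexVertex) (m : ℝ → ℤ) (b : ℝ → Sym2 HexVertex), AdmissibleFamily D ρ Λ m b → ∀ (a : ℝ → Sym2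 HexVertex) (r₀ : ℝ) (m₀ : ℝ → ℤ), PinnedFlatRoot D Λ b (D.pt 0) a r₀ m₀ → 2 * ρ < dist (D.pt 0) (D.pt 1) → ∀ η : ℝ, 0 < η → ∃ (P : DobrushinDomain) (ΛP : ℝ → Finset HexVertex), P.pt 0 = D.pt 0 ∧ P.pt 1 = D.pt 1 ∧ P.carrier ⊆ D.carrier ∧ {z : ℂ | z ∈ D.carrier ∧ η ≤ Metric.infDist z D.carrierᶜ} ⊆ P.carrier ∧ AdmissibleFamily P (ρ / 2) ΛP m b ∧ ExactPolygonFamily P ΛP ∧ PinnedFlatRoot P ΛP b (P.pt 0) a (min r₀ ρ / 4) m₀ ∧ ∀ᶠ δ : ℝ in 𝓝[>] 0, collarDomain D (3 * ρ / 4) (min r₀ ρ / 2) η δ (Λ δ) ⊆ ΛP δ ∧ ΛP δ ⊆ Λ δ) := by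
  intro H D ρ Λ m b hA a r₀ m₀ hP hd η hη
  obtain ⟨hρ, hD1, hev, hexh, hblim⟩ := id hA
  obtain ⟨hr₀, hD0r₀, hev0, halim⟩ := id hP
  set r₁ : ℝ := min r₀ ρ with hr₁def
  have hr₁ : 0 < r₁ := lt_min hr₀ hρ
  have hr₁r₀ : r₁ ≤ r₀ := min_le_left _ _
  have hr₁ρ : r₁ ≤ ρ := min_le_right _ _
  have hD0 : D.carrier ∩ ball (D.pt 0) r₁ = {z : ℂ | (D.pt 0).im < z.im} ∩ ball (D.pt 0) r₁ :=
    inter_eq_inter_of_subset hD0r₀ (ball_subset_ball hr₁r₀)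
  have hdist : ρ + r₁ ≤ dist (D.pt 0) (D.pt 1) := by linarith
  obtain ⟨P, Cor, r, h1, h2, h3, h4, h5, h6, h7, h8, h9, h10, h11, h12, h13, h14, h15⟩ :=
    H D ρ r₁ (η / 2) hρ hr₁ (half_pos hη) hD1 hD0 hdist
  obtain ⟨κ, Hκ⟩ := exists_chartFunction h15
  have hCor : ∀ c ∈ Cor, c ∈ frontier P.carrier := fun c hc => h11 (Finset.mem_coe.2 hc)
  have hF : ∀ w ∈ frontier P.carrier, w ∉ ball (D.pt 1) (15 * ρ / 16) → w ∉ ball (D.pt 0) (15 * r₁ / 16) →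
      w ∈ D.carrier := fun w hw hw1 hw0 => h7 ⟨hw, by rw [mem_union, not_or]; exact ⟨hw1, hw0⟩⟩
  have hηS : {z : ℂ | z ∈ D.carrier ∧ η / 2 ≤ infDist z D.carrierᶜ} ⊆ P.carrier := h4
  set ΛP : ℝ → Finset HexVertex := fun δ => zdLam P.carrier Cor κ r (D.pt 1) (D.pt 0) ρ r₁ Λ m m₀ δ with hΛP
  -- the sandwich and its frame
  have hsand : ∀ᶠ δ : ℝ in 𝓝[>] 0, collarDomain D (3 * ρ / 4) (r₁ / 2) η δ (Λ δ) ⊆ ΛP δ ∧ ΛP δ ⊆ Λ δ := by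
    filter_upwards [eventually_collar_subset_zdLam hA hP P.isOpen h3 h8 h9 h10 hr₁r₀ hη hηS h5 h6 hdist hCor h13 h14 Hκ]
      with δ hδ
    exact ⟨hδ, zdLam_subset _ _ _ _ _ _ _ _ _ _ _ _⟩
  have hA' : AdmissibleFamily D (3 * ρ / 4) Λ m b := admissibleFamily_of_le hA (by positivity) (by linarith)
  have hP' : PinnedFlatRoot D Λ b (D.pt 0) a (r₁ / 2) m₀ := pinnedFlatRoot_of_le hP (by positivity) (by linarith)
  have hframe := eventually_sandwich_frame D (3 * ρ / 4) Λ m b hA' a (r₁ / 2) m₀ hP' η ΛP hsand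
  have hC1 := eventually_preconnected (P := P) hA hP h3 h8 h9 h10 hr₁r₀ hD0 hF hdist hCor h13 h14 Hκ
  have hC2 := eventually_simplyConnected (P := P) hA hP h3 h8 h9 h10 hr₁r₀ hD0 hF hdist hCor h13 h14 Hκ
  have h01 : D.pt 0 ≠ D.pt 1 := fun h => absurd (D.pt_injective h) (by decide)
  -- the eventual clause of admissibility
  have hadm : ∀ᶠ δ : ℝ in 𝓝[>] 0, hexDomainSimplyConnected (ΛP δ) ∧ b δ ∈ hexDomainBoundary (ΛP δ) ∧
      (hexGraph.induce ((ΛP δ : Finset HexVertex) : Set HexVertex)).Preconnected ∧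
      (∀ v ∈ ΛP δ, (δ : ℂ) * hexCenter v ∈ P.carrier) ∧
      (∀ v : HexVertex, (δ : ℂ) * hexCenter v ∈ ball (P.pt 1) (ρ / 2) → (v ∈ ΛP δ ↔ m δ ≤ v.1 1)) := by
    filter_upwards [hC2, hframe, hC1] with δ hsc hfr hpc
    obtain ⟨-, hb, -, hpin1, -⟩ := hfr
    refine ⟨hsc, hb, hpc, fun v hv => mem_carrier_of_mem_zdLam hv, fun v hv => hpin1 v ?_⟩
    rw [h2] at hv
    exact ball_subset_ball (by linarith) hv
  refine ⟨P, ΛP, h1, h2, h3, fun z hz => h4 ⟨hz.1, by linarith [hz.2]⟩, ?_, ?_, ?_, hsand⟩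
  · -- admissibility with gate radius `ρ/2`
    refine ⟨half_pos hρ, ?_, hadm, ?_, by rw [h2]; exact hblim⟩
    · rw [h2]; exact inter_eq_inter_of_subset h5 (ball_subset_ball (by linarith))
    · intro K hK hKP
      have hPc : P.carrierᶜ.Nonempty := by
        by_contra h
        rw [not_nonempty_iff_eq_empty, compl_empty_iff] at h
        exact P.toJordanDomain.carrier_ne_univ h
      obtain ⟨t, ht, hKt⟩ := exists_pos_le_infDist hK P.isOpen hKP hPc
      filter_upwards [eventually_mem_zdLam_of_deep (r₁ := r₁) hA hP P.isOpen h3 h8 hCor h13 h14 Hκ ht] with δ hδ v hv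
      exact hδ v (hKt _ hv)
  · -- exact polygon family with the corners of `P` and radius `r/2`
    refine ⟨Cor, r / 2, by positivity, h11, fun i c hc => by linarith [h12 i c hc], ?_⟩
    filter_upwards [eventually_isFlatSideAt (P := P) hA hP h3 h8 h9 h10 hr₁r₀ hD0 hF hdist hCor h13 h14 Hκ,
      eventually_isCornerAt (P := P) hA hP h3 h8 h9 h10 hr₁r₀ hD0 hF hdist hCor h13 h14 Hκ] with δ hflatδ hcorδ z hz
    refine ⟨fun hfar => ?_, fun hzC => hcorδ z hzC⟩
    rw [show r / 2 / 2 = r / 4 by ring]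
    exact hflatδ z hz hfar
  · -- root pin with radius `min r₀ ρ / 4`
    refine ⟨by positivity, ?_, ?_, by rw [h1]; exact halim⟩
    · rw [h1]; exact inter_eq_inter_of_subset h6 (ball_subset_ball (by linarith))
    · have hwalks := eventually_nonempty_hexMidEdgeSAW ΛP a b (D.pt 0) (D.pt 1) h01 halim hblim (by
        filter_upwards [hC1, hframe] with δ hpc hfr
        exact ⟨hpc, hfr.1, hfr.2.1⟩)
      filter_upwards [hframe, hwalks] with δ hfr hw
      obtain ⟨ha, -, -, -, hpin0⟩ := hfr
      refine ⟨ha, hw, fun v hv => hpin0 v ?_⟩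
      rw [h1] at hv
      exact ball_subset_ball (by linarith) hv

end Summit.CriticalPhenomena.SAWScalingLimit.Theorems.PolygonParitySqueeze

end
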